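import Summits.FinalStateConjecture.FinalStateConjecture.Theorems.SwallowTheDatumUniversalWitnessFamilyRegionOneAssembly
import Literature.Geometry.Lorentzian.ExtensionProofs

/-!
# Route StarvedNecks — crux `HonestFixedRadiusSettling`, line `far-field-surgery` (reshape v6, sheet burial):
# stub `stub_regionOneFarCloseness` — part 1: real analysis of the bent hole chart far out

Auxiliary estimates for the registered stub `stub_regionOneFarCloseness` (honest clause Hf.3 of the sheet
burial: the hole chart `y ↦ holeMap M T₀ y` of the explicit `N = 1` decomposition of the Schwarzschild
exterior is `C⁰`-close to its Kerr–Schild background on `{t* ≥ T, r ≥ 100M}`).  On `{y⁰ ≥ T₀ + 1}` the hole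
map is the bent map `y ↦ y + β(y) e₀`, `β(y) = bend M y⁰ ‖ỹ‖ = torH(r) χ(r/S(t) − 1)`
(`χ = Real.smoothTransition`, `S = exactRadius M`), so everything reduces to the size of `dβ`:

* `hasFDerivAt_bendAt`, `fderiv_bendAt_apply` — the differential of `β`:
  `dβ(v) = ∂_t bend · v⁰ + (torH'(r) χ + torH(r) χ'/S) · ⟪ỹ, ṽ⟫/r`;
* `abs_bendR_le` — the radial coefficient is at most `1/49 + C torH(2S(t))/S(t)` for `r ≥ 100M`
  (`torH' = 2M/(r − 2M) ≤ 1/49`, `0 ≤ χ ≤ 1`, `|χ'| ≤ C`, and `χ' = 0` off the annulus `S < r < 2S`, on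
  which `torH(r) ≤ torH(2S)`), whence `abs_fderiv_bendAt_le` (with `|v⁰| ≤ ‖v‖`, `C0Extension.abs_apply_zero_le_norm`):
  `|dβ(v)| ≤ (C torH(2S)/t + C torH(2S)/S + 1/49) ‖v‖` (the `t`-part is `abs_deriv_bend_t_le`);
* `exists_farTime` — a time `T₁ > 0` after which `C torH(2S(t))/t + C torH(2S(t))/S(t) ≤ 1/55`
  (`torH(2S) ≲ M (t/M)^{1/4}`, `S ≳ M (t/M)^{1/2}`);
* `kerr_bilin_timeShift_sub`, `abs_timeShift_dev_le` — for the STATIONARY Schwarzschild Kerr–Schild form,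
  `g(x + c e₀)(v + a e₀, w + b e₀) − g(x)(v, w) = a g(e₀, w) + b g(v, e₀) + a b g(e₀, e₀)` in closed form, and
  its size is at most `(2δ + δ²) ‖v‖ ‖w‖` when `|a| ≤ δ‖v‖`, `|b| ≤ δ‖w‖`, `2M/r ≤ 1`.

References: Misner–Thorne–Wheeler 1973, §31.4 (tortoise coordinate); O'Neill 1983, Ch. 13; all elementary
real analysis and bilinear algebra here.
-/

set_option linter.dupNamespace false

noncomputable section

namespace Summit.FinalStateConjecture.FinalStateConjecture.Theorems.StarvedNecks.SheetBurial

open scoped Manifold ContDiff Topology RealInnerProductSpace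
open Set Filter Function Literature.Geometry.Lorentzian
open Summit.FinalStateConjecture.FinalStateConjecture.Theorems.SwallowTheDatum.UniversalWitnessFamily

/-! ## A norm comparison on `E4` -/

/-- `|⟪ỹ, ṽ⟫/‖ỹ‖| ≤ ‖v‖` (Cauchy–Schwarz and `‖ṽ‖ ≤ ‖v‖`; for `ỹ = 0` the left side is `0`). -/
theorem abs_inner_spatial_div_le (y v : E4) :
    |⟪E4.spatial y, E4.spatial v⟫ / E4.spatialNorm y| ≤ ‖v‖ := by
  have hsv : ‖E4.spatial v‖ ≤ ‖v‖ := by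
    have hsq : ‖v‖ ^ 2 = v 0 ^ 2 + ‖E4.spatial v‖ ^ 2 := by
      rw [EuclideanSpace.real_norm_sq_eq, Fin.sum_univ_four, ← E4.spatialNorm, E4.spatialNorm_sq]
      ring
    nlinarith [norm_nonneg v, norm_nonneg (E4.spatial v), sq_nonneg (v 0)]
  rcases eq_or_ne (E4.spatialNorm y) 0 with h0 | h0
  · rw [h0, div_zero, abs_zero]; exact norm_nonneg _
  · have hpos : 0 < E4.spatialNorm y := lt_of_le_of_ne (E4.spatialNorm_nonneg y) (Ne.symm h0)
    rw [abs_div, abs_of_pos hpos, div_le_iff₀ hpos]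
    calc |⟪E4.spatial y, E4.spatial v⟫| ≤ ‖E4.spatial y‖ * ‖E4.spatial v‖ := abs_real_inner_le_norm _ _
      _ ≤ ‖E4.spatial y‖ * ‖v‖ := mul_le_mul_of_nonneg_left hsv (norm_nonneg _)
      _ = ‖v‖ * E4.spatialNorm y := mul_comm _ _

/-! ## The differential of the bending `β(y) = bend M y⁰ ‖ỹ‖` -/

section Bend

variable {M : ℝ}

/-- **The differential of `y ↦ bend M y⁰ ‖ỹ‖`** at a point with `‖ỹ‖ > 2M`, assembled from the chain and
product rules (`torH' = 2M/(r − 2M)`, `d‖ỹ‖ = ⟪ỹ, ·̃⟫/‖ỹ‖`, `d(y⁰) = proj₀`). -/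
theorem hasFDerivAt_bendAt (hM : 0 < M) {y : E4} (hy : 2 * M < E4.spatialNorm y) :
    HasFDerivAt (fun z : E4 ↦ bend M (z 0) (E4.spatialNorm z))
      (torH M (E4.spatialNorm y) •
          (deriv Real.smoothTransition (E4.spatialNorm y / exactRadius M (y 0) - 1) •
            (E4.spatialNorm y • ((-(exactRadius M (y 0) ^ 2)⁻¹) •
                (deriv (exactRadius M) (y 0) • (EuclideanSpace.proj (0 : Fin 4) : E4 →L[ℝ] ℝ))) +
              (exactRadius M (y 0))⁻¹ •
                ((E4.spatialNorm y)⁻¹ • ((innerSL ℝ (E4.spatial y)).comp E4.spatial)))) +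
        Real.smoothTransition (E4.spatialNorm y / exactRadius M (y 0) - 1) •
          ((2 * M / (E4.spatialNorm y - 2 * M)) •
            ((E4.spatialNorm y)⁻¹ • ((innerSL ℝ (E4.spatial y)).comp E4.spatial)))) y := by
  have hr0 : E4.spatialNorm y ≠ 0 := by linarith
  have hS0 : 0 < exactRadius M (y 0) := exactRadius_pos hM _
  have h0 : HasFDerivAt (fun z : E4 ↦ z 0) (EuclideanSpace.proj (0 : Fin 4) : E4 →L[ℝ] ℝ) y :=
    (EuclideanSpace.proj (0 : Fin 4) : E4 →L[ℝ] ℝ).hasFDerivAt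
  have hρ := hasFDerivAt_spatialNorm hr0
  have hS : HasDerivAt (exactRadius M) (deriv (exactRadius M) (y 0)) (y 0) :=
    (differentiableAt_exactRadius M (y 0)).hasDerivAt
  have hSy := hS.comp_hasFDerivAt y h0
  have hinv := (hasDerivAt_inv hS0.ne').comp_hasFDerivAt y hSy
  have hu := (hρ.fun_mul hinv).sub_const 1
  have hfun : (fun z : E4 ↦ E4.spatialNorm z / exactRadius M (z 0) - 1) =
      fun z ↦ E4.spatialNorm z * ((fun x : ℝ ↦ x⁻¹) ∘ exactRadius M ∘ fun z : E4 ↦ z 0) z - 1 := by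
    funext z
    simp only [Function.comp_apply, div_eq_mul_inv]
  have hχ : HasDerivAt Real.smoothTransition
      (deriv Real.smoothTransition (E4.spatialNorm y / exactRadius M (y 0) - 1))
      (E4.spatialNorm y / exactRadius M (y 0) - 1) :=
    ((Real.smoothTransition.contDiff (n := 1)).differentiable (by norm_num)).differentiableAt.hasDerivAt
  have hu' : HasFDerivAt (fun z : E4 ↦ E4.spatialNorm z / exactRadius M (z 0) - 1)
      (E4.spatialNorm y • ((-(exactRadius M (y 0) ^ 2)⁻¹) •
          (deriv (exactRadius M) (y 0) • (EuclideanSpace.proj (0 : Fin 4) : E4 →L[ℝ] ℝ))) +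
        (exactRadius M (y 0))⁻¹ • ((E4.spatialNorm y)⁻¹ • ((innerSL ℝ (E4.spatial y)).comp E4.spatial))) y := by
    rw [hfun]
    exact hu
  have hχu := hχ.comp_hasFDerivAt y hu'
  have hT := (hasDerivAt_torH hM hy).comp_hasFDerivAt y hρ
  have hβ := hT.mul hχu
  exact hβ

/-- **`dβ(v) = ∂_t bend · v⁰ + (torH'(r) χ + torH(r) χ'/S) · ⟪ỹ, ṽ⟫/r`** (`r = ‖ỹ‖`, `t = y⁰`,
`S = S(t)`, `χ, χ'` evaluated at `r/S − 1`). -/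
theorem fderiv_bendAt_apply (hM : 0 < M) {y : E4} (hy : 2 * M < E4.spatialNorm y) (v : E4) :
    fderiv ℝ (fun z : E4 ↦ bend M (z 0) (E4.spatialNorm z)) y v =
      deriv (fun t ↦ bend M t (E4.spatialNorm y)) (y 0) * v 0 +
        (2 * M / (E4.spatialNorm y - 2 * M) *
              Real.smoothTransition (E4.spatialNorm y / exactRadius M (y 0) - 1) +
            torH M (E4.spatialNorm y) *
                deriv Real.smoothTransition (E4.spatialNorm y / exactRadius M (y 0) - 1) /
              exactRadius M (y 0)) *
          (⟪E4.spatial y, E4.spatial v⟫ / E4.spatialNorm y) := by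
  have hr0 : E4.spatialNorm y ≠ 0 := by linarith
  have hS0 : exactRadius M (y 0) ≠ 0 := (exactRadius_pos hM _).ne'
  rw [(hasFDerivAt_bendAt hM hy).fderiv, (hasDerivAt_bend_t hM (y 0) (E4.spatialNorm y)).deriv]
  simp only [add_apply, FunLike.coe_smul, Pi.smul_apply, ContinuousLinearMap.coe_comp,
    Function.comp_apply, innerSL_apply_apply, smul_eq_mul, EuclideanSpace.coe_proj]
  field_simp
  ring

/-- **The radial coefficient of `dβ` is small beyond `100M`:**
`|torH'(r) χ + torH(r) χ'/S| ≤ 1/49 + C torH(2S)/S` for `r ≥ 100M` (`|χ'| ≤ C`). -/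
theorem abs_bendR_le (hM : 0 < M) {C : ℝ} (hC : ∀ u : ℝ, |deriv Real.smoothTransition u| ≤ C)
    (hC0 : 0 ≤ C) (t : ℝ) {r : ℝ} (hr : 100 * M ≤ r) :
    |2 * M / (r - 2 * M) * Real.smoothTransition (r / exactRadius M t - 1) +
        torH M r * deriv Real.smoothTransition (r / exactRadius M t - 1) / exactRadius M t| ≤
      1 / 49 + C * torH M (2 * exactRadius M t) / exactRadius M t := by
  set S := exactRadius M t with hSdef
  have hS0 : 0 < S := exactRadius_pos hM t
  have hTS : 0 ≤ torH M (2 * S) :=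
    torH_nonneg hM (by rw [hSdef, exactRadius_eq]; linarith [le_growth hM t])
  have hr2 : 0 < r - 2 * M := by linarith
  -- the `torH'` term
  have h1 : |2 * M / (r - 2 * M) * Real.smoothTransition (r / S - 1)| ≤ 1 / 49 := by
    have hk0 : 0 ≤ 2 * M / (r - 2 * M) := by positivity
    have hk : 2 * M / (r - 2 * M) ≤ 1 / 49 := by
      rw [div_le_div_iff₀ hr2 (by norm_num : (0 : ℝ) < 49)]; linarith
    rw [abs_mul, abs_of_nonneg hk0, abs_of_nonneg (Real.smoothTransition.nonneg _)]
    calc 2 * M / (r - 2 * M) * Real.smoothTransition (r / S - 1) ≤ 1 / 49 * 1 :=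
          mul_le_mul hk (Real.smoothTransition.le_one _) (Real.smoothTransition.nonneg _) (by norm_num)
      _ = 1 / 49 := by norm_num
  -- the `χ'` term
  have h2 : |torH M r * deriv Real.smoothTransition (r / S - 1) / S| ≤ C * torH M (2 * S) / S := by
    by_cases hzone : S < r ∧ r < 2 * S
    · obtain ⟨hSr, hr2S⟩ := hzone
      have hr4 : 4 * M ≤ r := by linarith
      have htor : |torH M r| ≤ torH M (2 * S) := by
        rw [abs_of_nonneg (torH_nonneg hM hr4)]
        exact torH_le_torH hM (by linarith) hr2S.le
      rw [abs_div, abs_mul, abs_of_pos hS0]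
      refine div_le_div_of_nonneg_right ?_ hS0.le
      rw [mul_comm C]
      exact mul_le_mul htor (hC _) (abs_nonneg _) hTS
    · have hu : r / S - 1 ≤ 0 ∨ 1 ≤ r / S - 1 := by
        rcases not_and_or.1 hzone with h | h
        · left
          rw [sub_nonpos, div_le_one hS0]
          exact not_lt.1 h
        · right
          rw [le_sub_iff_add_le, le_div_iff₀ hS0]
          linarith [not_lt.1 h]
      rw [deriv_smoothTransition_eq_zero hu, mul_zero, zero_div, abs_zero]
      positivity
  exact (abs_add_le _ _).trans (add_le_add h1 h2)

/-- **The bound on `dβ` far out:** for `‖ỹ‖ ≥ 100M` and `y⁰ > 0`,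
`|dβ_y(v)| ≤ (C torH(2S)/t + (1/49 + C torH(2S)/S)) ‖v‖`, `t = y⁰`, `S = S(t)`. -/
theorem abs_fderiv_bendAt_le (hM : 0 < M) {C : ℝ} (hC : ∀ u : ℝ, |deriv Real.smoothTransition u| ≤ C)
    (hC0 : 0 ≤ C) {y : E4} (hy : 100 * M ≤ E4.spatialNorm y) (ht : 0 < y 0) (v : E4) :
    |fderiv ℝ (fun z : E4 ↦ bend M (z 0) (E4.spatialNorm z)) y v| ≤
      (C * torH M (2 * exactRadius M (y 0)) / y 0 +
          (1 / 49 + C * torH M (2 * exactRadius M (y 0)) / exactRadius M (y 0))) * ‖v‖ := by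
  have hy2 : 2 * M < E4.spatialNorm y := by linarith
  have hTS : 0 ≤ torH M (2 * exactRadius M (y 0)) :=
    torH_nonneg hM (by rw [exactRadius_eq]; linarith [le_growth hM (y 0)])
  have hS0 : 0 < exactRadius M (y 0) := exactRadius_pos hM _
  rw [fderiv_bendAt_apply hM hy2 v]
  have e1 : |deriv (fun t ↦ bend M t (E4.spatialNorm y)) (y 0) * v 0| ≤
      C * torH M (2 * exactRadius M (y 0)) / y 0 * ‖v‖ := by
    rw [abs_mul]
    exact mul_le_mul (abs_deriv_bend_t_le hM hC hC0 ht hy2) (C0Extension.abs_apply_zero_le_norm v) (abs_nonneg _)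
      (by positivity)
  have e2 : |(2 * M / (E4.spatialNorm y - 2 * M) *
              Real.smoothTransition (E4.spatialNorm y / exactRadius M (y 0) - 1) +
            torH M (E4.spatialNorm y) *
                deriv Real.smoothTransition (E4.spatialNorm y / exactRadius M (y 0) - 1) /
              exactRadius M (y 0)) *
          (⟪E4.spatial y, E4.spatial v⟫ / E4.spatialNorm y)| ≤
      (1 / 49 + C * torH M (2 * exactRadius M (y 0)) / exactRadius M (y 0)) * ‖v‖ := by
    rw [abs_mul]
    exact mul_le_mul (abs_bendR_le hM hC hC0 (y 0) hy) (abs_inner_spatial_div_le y v) (abs_nonneg _)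
      (by positivity)
  calc _ ≤ _ := abs_add_le _ _
    _ ≤ C * torH M (2 * exactRadius M (y 0)) / y 0 * ‖v‖ +
          (1 / 49 + C * torH M (2 * exactRadius M (y 0)) / exactRadius M (y 0)) * ‖v‖ := add_le_add e1 e2
    _ = _ := by ring

/-! ## The choice of the far time -/

/-- **Choice of the far time.** There is `T₁ > 0` (depending on `M` and the bound `C` on `χ'`) with
`C torH(2S(t))/t + C torH(2S(t))/S(t) ≤ 1/55` for all `t ≥ T₁`: with `s = (t/M)^{1/4} ≥ max 1 (1100 C)`,
`torH(2S) ≤ 16 M s`, `t = M s⁴`, `S ≥ 4 M s²`, so the left side is at most `20 C/s`. -/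
theorem exists_farTime (hM : 0 < M) {C : ℝ} (hC0 : 0 ≤ C) :
    ∃ T₁ : ℝ, 0 < T₁ ∧ ∀ t : ℝ, T₁ ≤ t →
      C * torH M (2 * exactRadius M t) / t + C * torH M (2 * exactRadius M t) / exactRadius M t ≤ 1 / 55 := by
  set s₀ : ℝ := max 1 (1100 * C) with hs₀
  have hs₀1 : 1 ≤ s₀ := le_max_left _ _
  have hs₀C : 1100 * C ≤ s₀ := le_max_right _ _
  refine ⟨M * s₀ ^ 4, by positivity, fun t ht ↦ ?_⟩
  have ht0 : 0 < t := lt_of_lt_of_le (by positivity) ht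
  set σ := t / M with hσ
  have hσt : t = M * σ := by rw [hσ]; field_simp
  have hσ0 : s₀ ^ 4 ≤ σ := by rw [hσ, le_div_iff₀ hM]; linarith
  have hσnn : 0 ≤ σ := le_trans (by positivity) hσ0
  set s := Real.sqrt (Real.sqrt σ) with hs
  have hsnn : 0 ≤ s := Real.sqrt_nonneg _
  have hsq : Real.sqrt σ = s ^ 2 := by rw [hs, Real.sq_sqrt (Real.sqrt_nonneg _)]
  have hσs : σ = s ^ 4 := by
    calc σ = (Real.sqrt σ) ^ 2 := (Real.sq_sqrt hσnn).symm
      _ = s ^ 4 := by rw [hsq]; ring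
  have hs0 : s₀ ≤ s := by
    have h4 : s₀ ^ 4 ≤ s ^ 4 := hσs ▸ hσ0
    exact le_of_pow_le_pow_left₀ (by norm_num) hsnn h4
  have hs1 : 1 ≤ s := hs₀1.trans hs0
  have hsC : 1100 * C ≤ s := hs₀C.trans hs0
  have hspos : 0 < s := by linarith
  -- `torH(2S) ≤ 16 M s`
  have hT : torH M (2 * exactRadius M t) ≤ 16 * M * s := by
    refine (torH_two_mul_exactRadius_le hM ht0.le).trans ?_
    rw [← hσ, hsq]
    have h16 : Real.sqrt (7 + 4 * s ^ 2) ≤ 4 * s := by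
      rw [show 4 * s = Real.sqrt ((4 * s) ^ 2) by rw [Real.sqrt_sq (by positivity)]]
      exact Real.sqrt_le_sqrt (by nlinarith)
    nlinarith [hM]
  -- `S ≥ 4 M s²`
  have hS : 4 * M * s ^ 2 ≤ exactRadius M t := by
    rw [exactRadius_eq, growth_eq, ← hσ]
    have h2 : s ^ 2 ≤ Real.sqrt (Real.sqrt (1 + σ ^ 2)) := by
      rw [← hsq]
      refine Real.sqrt_le_sqrt ?_
      calc σ = Real.sqrt (σ ^ 2) := (Real.sqrt_sq hσnn).symm
        _ ≤ Real.sqrt (1 + σ ^ 2) := Real.sqrt_le_sqrt (by linarith)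
    nlinarith [hM]
  have hSpos : 0 < exactRadius M t := exactRadius_pos hM t
  -- the two terms
  have h1 : C * torH M (2 * exactRadius M t) / t ≤ 16 * C / s := by
    rw [div_le_iff₀ ht0]
    have hs3 : s ≤ s ^ 3 := by nlinarith [mul_nonneg hsnn (mul_nonneg (sub_nonneg.2 hs1) hsnn)]
    calc C * torH M (2 * exactRadius M t) ≤ C * (16 * M * s) := mul_le_mul_of_nonneg_left hT hC0
      _ ≤ C * (16 * M * s ^ 3) := by gcongr
      _ = 16 * C / s * t := by rw [hσt, hσs]; field_simp
  have h2 : C * torH M (2 * exactRadius M t) / exactRadius M t ≤ 4 * C / s := by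
    rw [div_le_iff₀ hSpos]
    calc C * torH M (2 * exactRadius M t) ≤ C * (16 * M * s) := mul_le_mul_of_nonneg_left hT hC0
      _ = 4 * C / s * (4 * M * s ^ 2) := by field_simp; ring
      _ ≤ 4 * C / s * exactRadius M t := mul_le_mul_of_nonneg_left hS (by positivity)
  calc C * torH M (2 * exactRadius M t) / t + C * torH M (2 * exactRadius M t) / exactRadius M t
      ≤ 16 * C / s + 4 * C / s := add_le_add h1 h2
    _ = 20 * C / s := by ring
    _ ≤ 1 / 55 := by rw [div_le_iff₀ hspos]; linarith

end Bend

/-! ## The stationary Schwarzschild form under a time shift -/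

section Form

variable {M : ℝ}

/-- **Time shifts and the stationary form.** For `‖x̃‖ = r ≠ 0`, `h = 2M/r`, `s_v = ⟪x̃, ṽ⟫/r`:
`g(x + c e₀)(v + a e₀, w + b e₀) − g(x)(v, w)
  = a (−w⁰ + h (w⁰ + s_w)) + b (−v⁰ + h (v⁰ + s_v)) + a b (−1 + h)`
(the Kerr–Schild Schwarzschild form depends on `x` only through `x̃`). -/
theorem kerr_bilin_timeShift_sub {x : E4} (hx : E4.spatialNorm x ≠ 0) (c a b : ℝ) (v w : E4) :
    Kerr.bilin M 0 (x + c • E4.basisVector 0) (v + a • E4.basisVector 0) (w + b • E4.basisVector 0) -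
        Kerr.bilin M 0 x v w =
      a * (-(w 0) + 2 * M / E4.spatialNorm x * (w 0 + ⟪E4.spatial x, E4.spatial w⟫ / E4.spatialNorm x)) +
        b * (-(v 0) + 2 * M / E4.spatialNorm x * (v 0 + ⟪E4.spatial x, E4.spatial v⟫ / E4.spatialNorm x)) +
          a * b * (-1 + 2 * M / E4.spatialNorm x) := by
  have hx' : E4.spatialNorm (x + c • E4.basisVector 0) ≠ 0 := by rwa [spatialNorm_add_smul_basisVector]
  have h1 : ∀ (u : E4) (c : ℝ), (u + c • E4.basisVector 0) 0 = u 0 + c := fun u c ↦ by simp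
  rw [kerr_bilin_zero_spin hx', kerr_bilin_zero_spin hx, spatialNorm_add_smul_basisVector,
    spatial_add_smul_basisVector, spatial_add_smul_basisVector, spatial_add_smul_basisVector, h1, h1]
  ring

/-- **Size of the time-shift deviation.** With `0 ≤ h ≤ 1`, `|w⁰|, |s_w| ≤ ‖w‖`, `|v⁰|, |s_v| ≤ ‖v‖`,
`|a| ≤ δ ‖v‖`, `|b| ≤ δ ‖w‖` (`δ ≥ 0`):
`|a (−w⁰ + h (w⁰ + s_w)) + b (−v⁰ + h (v⁰ + s_v)) + a b (−1 + h)| ≤ (2δ + δ²) ‖v‖ ‖w‖`. -/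
theorem abs_timeShift_dev_le {h a b δ v0 w0 sv sw nv nw : ℝ} (hh0 : 0 ≤ h) (hh1 : h ≤ 1)
    (hδ : 0 ≤ δ) (hnv : 0 ≤ nv) (hnw : 0 ≤ nw) (hv0 : |v0| ≤ nv) (hw0 : |w0| ≤ nw) (hsv : |sv| ≤ nv)
    (hsw : |sw| ≤ nw) (ha : |a| ≤ δ * nv) (hb : |b| ≤ δ * nw) :
    |a * (-w0 + h * (w0 + sw)) + b * (-v0 + h * (v0 + sv)) + a * b * (-1 + h)| ≤
      (2 * δ + δ ^ 2) * nv * nw := by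
  have hW : |-w0 + h * (w0 + sw)| ≤ nw := by
    have : -w0 + h * (w0 + sw) = -((1 - h) * w0) + h * sw := by ring
    rw [this]
    refine (abs_add_le _ _).trans ?_
    rw [abs_neg, abs_mul, abs_mul, abs_of_nonneg (by linarith : (0 : ℝ) ≤ 1 - h), abs_of_nonneg hh0]
    nlinarith [mul_le_mul_of_nonneg_left hw0 (by linarith : (0 : ℝ) ≤ 1 - h),
      mul_le_mul_of_nonneg_left hsw hh0]
  have hV : |-v0 + h * (v0 + sv)| ≤ nv := by
    have : -v0 + h * (v0 + sv) = -((1 - h) * v0) + h * sv := by ring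
    rw [this]
    refine (abs_add_le _ _).trans ?_
    rw [abs_neg, abs_mul, abs_mul, abs_of_nonneg (by linarith : (0 : ℝ) ≤ 1 - h), abs_of_nonneg hh0]
    nlinarith [mul_le_mul_of_nonneg_left hv0 (by linarith : (0 : ℝ) ≤ 1 - h),
      mul_le_mul_of_nonneg_left hsv hh0]
  have hH : |-1 + h| ≤ 1 := by rw [abs_le]; constructor <;> linarith
  have hδv : 0 ≤ δ * nv := mul_nonneg hδ hnv
  have hδw : 0 ≤ δ * nw := mul_nonneg hδ hnw
  have e1 : |a * (-w0 + h * (w0 + sw))| ≤ δ * nv * nw := by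
    rw [abs_mul]
    exact mul_le_mul ha hW (abs_nonneg _) hδv
  have e2 : |b * (-v0 + h * (v0 + sv))| ≤ δ * nw * nv := by
    rw [abs_mul]
    exact mul_le_mul hb hV (abs_nonneg _) hδw
  have e3 : |a * b * (-1 + h)| ≤ δ * nv * (δ * nw) * 1 := by
    rw [abs_mul, abs_mul]
    exact mul_le_mul (mul_le_mul ha hb (abs_nonneg _) hδv) hH (abs_nonneg _) (mul_nonneg hδv hδw)
  calc |a * (-w0 + h * (w0 + sw)) + b * (-v0 + h * (v0 + sv)) + a * b * (-1 + h)|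
      ≤ |a * (-w0 + h * (w0 + sw))| + |b * (-v0 + h * (v0 + sv))| + |a * b * (-1 + h)| :=
        (abs_add_le _ _).trans (add_le_add (abs_add_le _ _) le_rfl)
    _ ≤ δ * nv * nw + δ * nw * nv + δ * nv * (δ * nw) * 1 := add_le_add (add_le_add e1 e2) e3
    _ = (2 * δ + δ ^ 2) * nv * nw := by ring

end Form

/-- **Anchor of part 1** (registered sub-goal of `stub_regionOneFarCloseness`): after a far time the two
quantities controlling the differential of the bending beyond `100M` are below `1/55`. -/
theorem farCloseness_farTime : ∀ (M C : ℝ), 0 < M → 0 ≤ C → ∃ T₁ : ℝ, 0 < T₁ ∧ ∀ t : ℝ, T₁ ≤ t → C * torH M (2 * exactRadius M t) / t + C * torH M (2 * exactRadius M t) / exactRadius M t ≤ 1 / 55 := by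
  intro M C hM hC0
  exact exists_farTime hM hC0

end Summit.FinalStateConjecture.FinalStateConjecture.Theorems.StarvedNecks.SheetBurial

end
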